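import Summits.CriticalPhenomena.SAWScalingLimit.Theses.SAWRenewalTightness
import Literature.Probability.RandomPlanarGeometry.ChordalCurveFamily
import Literature.Topology.PlaneTopology.Schoenflies
import Literature.Probability.RandomPlanarGeometry.ConformalTube
import HarnessLib

/-!
# `ShellCrossingBound`, line `pinch-on-a-circle`, stub C `stub_socketedEnlargement`:
# a socketed enlargement of a Dobrushin domain with room

Crux item `stmt-CriticalPhenomena-4728` (`SAWRenewalTightness.ShellCrossingBound`), registered stub
`stub_socketedEnlargement` of the line skeleton `pinch-on-a-circle` (hypothesis `hC` of
`ShellCrossingBound_of`). Pure plane topology, no probability: for a Dobrushin domain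
`(D; a, b)` and `d > 0` there is a Dobrushin domain `D' ⊇ D` with the SAME two marked points,
EQUAL to `D` inside the two open sockets `B(a, d/2) ∪ B(b, d/2)`, and containing a uniform closed
`ε`-collar about every point of `closure D` at distance `≥ d` from `a` and `b`.

## Construction

* Schoenflies (`Literature.Topology.PlaneTopology.Schoenflies.extendHomeomorph`, Pommerenke (1992)
  Cor. 2.8): a homeomorphism `H : ℂ ≃ₜ ℂ` with `H(𝔻) = D`, `H(𝕋) = ∂D`.
* The exceptional closed set `K = H⁻¹(S) ∩ {1 ≤ ‖w‖}`, `S = B̄(a, d/2) ∪ B̄(b, d/2)`; it contains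
  `H⁻¹(a)`, `H⁻¹(b)`.
* The stretch factor `g(z) = 1 + min 1 (infDist (z/‖z‖) K / 2) ∈ [1, 2]`, a function of the
  direction only, `= 1` exactly in the directions of `K ∩ 𝕋`, and the radial stretch
  `Ψ(z) = g(z) z`, a homeomorphism of `ℂ` with `Ψ⁻¹(z) = z / g(z)`, so that
  `z ∈ Ψ(𝔻) ↔ ‖z‖ < g(z)`.
* `D' = Φ(D)`, `Φ = H ∘ Ψ ∘ H⁻¹` (`MarkedDomain.map`): then `p ∈ D' ↔ ‖H⁻¹ p‖ < g(H⁻¹ p)`, whence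
  `D ⊆ D'` (`g ≥ 1`), the marked points are fixed (`g = 1` on `K ∩ 𝕋`), `D' ∩ S ⊆ D` (a point
  `w = H⁻¹ p ∈ K` with `1 ≤ ‖w‖` has `g(w) ≤ 1 + dist(w/‖w‖, w)/2 = (1 + ‖w‖)/2 ≤ ‖w‖`), and every
  frontier point of `D` outside `S` lies in `D'` (`g > 1` off `K` on `𝕋`); the collar width `ε`
  comes from compactness (`IsCompact.exists_cthickening_subset_open`).

## References

* Ch. Pommerenke, *Boundary Behaviour of Conformal Maps* (1992), §2.3 Cor. 2.8 (Schoenflies via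
  Carathéodory) [PommerenkeBBCM1992].
* W. Werner, *Lectures on two-dimensional critical percolation* (2007), §3.2 (images of marked
  domains under plane homeomorphisms) [Werner2007].
-/

noncomputable section

open Set Metric Filter Topology
open Literature.Probability.RandomPlanarGeometry Literature.Probability.LatticeModels

namespace Summit.CriticalPhenomena.SAWScalingLimit.Theorems

/-! ### Radial stretches of the plane -/

/-- A map `z ↦ f(z) • z` with a bounded real factor `f`, continuous off the origin, is continuous
on `ℂ` (at the origin because `‖f(z) z‖ ≤ C ‖z‖`). [folklore] -/
theorem continuous_ofReal_mul_self {f : ℂ → ℝ} (hf : ∀ z, z ≠ 0 → ContinuousAt f z) {C : ℝ}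
    (hC : ∀ z, |f z| ≤ C) : Continuous fun z : ℂ => (f z : ℂ) * z := by
  rw [continuous_iff_continuousAt]
  intro z
  by_cases hz : z = 0
  · subst hz
    simp only [ContinuousAt, mul_zero]
    refine squeeze_zero_norm (a := fun w => C * ‖w‖) (fun w => ?_) ?_
    · rw [norm_mul, Complex.norm_real, Real.norm_eq_abs]
      exact mul_le_mul_of_nonneg_right (hC w) (norm_nonneg _)
    · have h : Tendsto (fun w : ℂ => C * ‖w‖) (𝓝 0) (𝓝 (C * 0)) :=
        tendsto_const_nhds.mul tendsto_norm_zero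
      rwa [mul_zero] at h
  · exact (Complex.continuous_ofReal.continuousAt.comp (hf z hz)).mul continuousAt_id

/-- The direction `z / ‖z‖` is unchanged by a positive real dilation. [folklore] -/
theorem inv_norm_mul_real_mul {t : ℝ} (ht : 0 < t) (z : ℂ) :
    (‖(t : ℂ) * z‖ : ℂ)⁻¹ * ((t : ℂ) * z) = (‖z‖ : ℂ)⁻¹ * z := by
  have ht' : (t : ℂ) ≠ 0 := Complex.ofReal_ne_zero.2 ht.ne'
  rw [norm_mul, Complex.norm_real, Real.norm_eq_abs, abs_of_pos ht, Complex.ofReal_mul, mul_inv,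
    mul_mul_mul_comm, inv_mul_cancel₀ ht', one_mul]

/-- **The radial stretch.** For a factor `g : ℂ → [1, 2]` depending only on the direction
(`g (t z) = g z` for real `t > 0`) and continuous off the origin, `Ψ(z) = g(z) z` is a
homeomorphism of `ℂ` (inverse `z ↦ z / g(z)`), and `Ψ` maps the open unit disc onto
`{z | ‖z‖ < g z}`: `‖Ψ⁻¹ z‖ < 1 ↔ ‖z‖ < g z`. Cf. Pommerenke's radial extension
`ψ(rζ) = rψ(ζ)` (proof of Cor. 2.9). [folklore] -/
theorem exists_radialStretch {g : ℂ → ℝ} (h1 : ∀ z, 1 ≤ g z) (h2 : ∀ z, g z ≤ 2)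
    (hsc : ∀ t : ℝ, 0 < t → ∀ z, g ((t : ℂ) * z) = g z) (hc : ∀ z, z ≠ 0 → ContinuousAt g z) :
    ∃ Ψ : ℂ ≃ₜ ℂ, (∀ z, Ψ z = (g z : ℂ) * z) ∧ ∀ z, ‖Ψ.symm z‖ < 1 ↔ ‖z‖ < g z := by
  have h0 : ∀ z, 0 < g z := fun z => one_pos.trans_le (h1 z)
  let Ψ : ℂ ≃ₜ ℂ :=
    { toFun := fun z => (g z : ℂ) * z
      invFun := fun z => ((g z)⁻¹ : ℝ) * z
      left_inv := fun z => by
        show (((g ((g z : ℂ) * z))⁻¹ : ℝ) : ℂ) * ((g z : ℂ) * z) = z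
        rw [hsc _ (h0 z) z, ← mul_assoc, ← Complex.ofReal_mul, inv_mul_cancel₀ (h0 z).ne',
          Complex.ofReal_one, one_mul]
      right_inv := fun z => by
        show ((g ((((g z)⁻¹ : ℝ) : ℂ) * z) : ℝ) : ℂ) * ((((g z)⁻¹ : ℝ) : ℂ) * z) = z
        rw [hsc _ (inv_pos.2 (h0 z)) z, ← mul_assoc, ← Complex.ofReal_mul,
          mul_inv_cancel₀ (h0 z).ne', Complex.ofReal_one, one_mul]
      continuous_toFun := continuous_ofReal_mul_self (C := 2) hc fun z => by
        rw [abs_of_pos (h0 z)]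
        exact h2 z
      continuous_invFun := continuous_ofReal_mul_self (C := 1)
        (fun z hz => (hc z hz).inv₀ (h0 z).ne') fun z => by
          rw [abs_of_pos (inv_pos.2 (h0 z))]
          exact inv_le_one_of_one_le₀ (h1 z) }
  refine ⟨Ψ, fun z => rfl, fun z => ?_⟩
  show ‖(((g z)⁻¹ : ℝ) : ℂ) * z‖ < 1 ↔ ‖z‖ < g z
  rw [norm_mul, Complex.norm_real, Real.norm_eq_abs, abs_of_pos (inv_pos.2 (h0 z)),
    inv_mul_lt_iff₀ (h0 z), mul_one]

/-- **The stretch factor of a closed nonempty exceptional set `K`**: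
`g(z) = 1 + min 1 (infDist (z/‖z‖) K / 2)`. It takes values in `[1, 2]`, depends only on the
direction, is continuous off the origin, equals `1` at the unit vectors of `K`, exceeds `1` at
the unit vectors off `K`, and satisfies `g(w) ≤ ‖w‖` at every `w ∈ K` with `‖w‖ ≥ 1` (because
`infDist (w/‖w‖) K ≤ dist (w/‖w‖) w = ‖w‖ - 1`). [folklore] -/
theorem exists_stretchFactor {K : Set ℂ} (hKc : IsClosed K) (hKne : K.Nonempty) :
    ∃ g : ℂ → ℝ, (∀ z, 1 ≤ g z) ∧ (∀ z, g z ≤ 2) ∧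
      (∀ t : ℝ, 0 < t → ∀ z, g ((t : ℂ) * z) = g z) ∧
      (∀ z, z ≠ 0 → ContinuousAt g z) ∧
      (∀ u, ‖u‖ = 1 → u ∈ K → g u = 1) ∧
      (∀ u, ‖u‖ = 1 → u ∉ K → 1 < g u) ∧
      (∀ w, 1 ≤ ‖w‖ → w ∈ K → g w ≤ ‖w‖) := by
  refine ⟨fun z => 1 + min 1 (infDist ((‖z‖ : ℂ)⁻¹ * z) K / 2), fun z => ?_, fun z => ?_,
    fun t ht z => ?_, fun z hz => ?_, fun u hu huK => ?_, fun u hu huK => ?_, fun w hw hwK => ?_⟩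
  · show 1 ≤ 1 + min 1 (infDist ((‖z‖ : ℂ)⁻¹ * z) K / 2)
    have : 0 ≤ min 1 (infDist ((‖z‖ : ℂ)⁻¹ * z) K / 2) :=
      le_min zero_le_one (div_nonneg infDist_nonneg zero_le_two)
    linarith
  · show 1 + min 1 (infDist ((‖z‖ : ℂ)⁻¹ * z) K / 2) ≤ 2
    have := min_le_left (1 : ℝ) (infDist ((‖z‖ : ℂ)⁻¹ * z) K / 2)
    linarith
  · show 1 + min 1 (infDist ((‖(t : ℂ) * z‖ : ℂ)⁻¹ * ((t : ℂ) * z)) K / 2) =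
      1 + min 1 (infDist ((‖z‖ : ℂ)⁻¹ * z) K / 2)
    rw [inv_norm_mul_real_mul ht]
  · have hdir : ContinuousAt (fun w : ℂ => (‖w‖ : ℂ)⁻¹ * w) z :=
      ((Complex.continuous_ofReal.comp continuous_norm).continuousAt.inv₀
        (by simpa using hz)).mul continuousAt_id
    have hg : Continuous fun w : ℂ => 1 + min 1 (infDist w K / 2) :=
      continuous_const.add (continuous_const.min ((continuous_infDist_pt K).div_const 2))
    exact hg.continuousAt.comp hdir
  · show 1 + min 1 (infDist ((‖u‖ : ℂ)⁻¹ * u) K / 2) = 1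
    rw [hu, Complex.ofReal_one, inv_one, one_mul, infDist_zero_of_mem huK, zero_div,
      min_eq_right zero_le_one, add_zero]
  · show 1 < 1 + min 1 (infDist ((‖u‖ : ℂ)⁻¹ * u) K / 2)
    rw [hu, Complex.ofReal_one, inv_one, one_mul]
    have h₁ := (hKc.notMem_iff_infDist_pos hKne).1 huK
    have h₂ : 0 < min 1 (infDist u K / 2) := lt_min one_pos (half_pos h₁)
    linarith
  · show 1 + min 1 (infDist ((‖w‖ : ℂ)⁻¹ * w) K / 2) ≤ ‖w‖
    have hw0 : 0 < ‖w‖ := one_pos.trans_le hw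
    have hdist : dist ((‖w‖ : ℂ)⁻¹ * w) w = ‖w‖ - 1 := by
      rw [dist_eq_norm, ← sub_one_mul, norm_mul,
        show ((‖w‖ : ℂ)⁻¹ - 1) = ((‖w‖⁻¹ - 1 : ℝ) : ℂ) by
          rw [Complex.ofReal_sub, Complex.ofReal_inv, Complex.ofReal_one],
        Complex.norm_real, Real.norm_eq_abs,
        abs_of_nonpos (sub_nonpos.2 (inv_le_one_of_one_le₀ hw)), neg_sub, sub_mul, one_mul,
        inv_mul_cancel₀ hw0.ne']
    have h₁ : infDist ((‖w‖ : ℂ)⁻¹ * w) K ≤ ‖w‖ - 1 := hdist ▸ infDist_le_dist_of_mem hwK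
    have h₂ := min_le_right (1 : ℝ) (infDist ((‖w‖ : ℂ)⁻¹ * w) K / 2)
    linarith

/-! ### The registered stub -/

/-- **STUB C `stub_socketedEnlargement`: socketed enlargement with room.** For a Dobrushin domain
`(D; a, b)` (`a = D.pt 0`, `b = D.pt 1`) and `d > 0` there are a Dobrushin domain `D'` and
`ε > 0` with `D ⊆ D'`, the same marked points, `D' ∩ (B(a, d/2) ∪ B(b, d/2)) ⊆ D`, and
`B̄(z, ε) ⊆ D'` for every `z ∈ closure D` with `dist z a ≥ d`, `dist z b ≥ d`.
Proof: `D' = Φ(D)` with `Φ = H ∘ Ψ ∘ H⁻¹`, `H` the Schoenflies homeomorphism of `D`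
(Pommerenke (1992) Cor. 2.8) and `Ψ` the radial stretch by the factor of `exists_stretchFactor`
for `K = H⁻¹(B̄(a, d/2) ∪ B̄(b, d/2)) ∩ {1 ≤ ‖w‖}`; the collar by compactness.
[cite: PommerenkeBBCM1992, §2.3 Cor. 2.8 (p. 25)] -/
theorem stub_socketedEnlargement :
    ∀ (D : DobrushinDomain) (d : ℝ), 0 < d →
      ∃ (D' : DobrushinDomain) (ε : ℝ), 0 < ε ∧ D.carrier ⊆ D'.carrier ∧
        D'.pt 0 = D.pt 0 ∧ D'.pt 1 = D.pt 1 ∧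
        D'.carrier ∩ (Metric.ball (D.pt 0) (d / 2) ∪ Metric.ball (D.pt 1) (d / 2)) ⊆ D.carrier ∧
        ∀ z ∈ closure D.carrier, d ≤ dist z (D.pt 0) → d ≤ dist z (D.pt 1) →
          Metric.closedBall z ε ⊆ D'.carrier := by
  intro D d hd
  /- (1) Schoenflies: `H : ℂ ≃ₜ ℂ` with `H(𝔻) = D`, `H(𝕋) = ∂D`. -/
  obtain ⟨T⟩ := D.toJordanDomain.nonempty_tubeData
  obtain ⟨H, hball, hsphere⟩ : ∃ H : ℂ ≃ₜ ℂ, H '' ball 0 1 = D.carrier ∧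
      H '' sphere 0 1 = frontier D.carrier :=
    ⟨_, Literature.Topology.PlaneTopology.Schoenflies.image_ball T,
      Literature.Topology.PlaneTopology.Schoenflies.image_sphere T⟩
  have hmemD : ∀ w, H w ∈ D.carrier ↔ ‖w‖ < 1 := fun w => by
    rw [← hball, H.injective.mem_set_image, mem_ball_zero_iff]
  have hmemFr : ∀ w, H w ∈ frontier D.carrier ↔ ‖w‖ = 1 := fun w => by
    rw [← hsphere, H.injective.mem_set_image, mem_sphere_zero_iff_norm]
  have hsymmD : ∀ p, p ∈ D.carrier → ‖H.symm p‖ < 1 := fun p hp => by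
    rwa [← hmemD, H.apply_symm_apply]
  have hsymmFr : ∀ p, p ∈ frontier D.carrier → ‖H.symm p‖ = 1 := fun p hp => by
    rwa [← hmemFr, H.apply_symm_apply]
  /- (2) The exceptional closed set `K = H⁻¹(S) ∩ {1 ≤ ‖w‖}`, `S` the two closed sockets. -/
  obtain ⟨K, hK⟩ : ∃ K : Set ℂ,
      K = H ⁻¹' (closedBall (D.pt 0) (d / 2) ∪ closedBall (D.pt 1) (d / 2)) ∩ {w | 1 ≤ ‖w‖} :=
    ⟨_, rfl⟩
  have hmemK : ∀ w, w ∈ K ↔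
      H w ∈ closedBall (D.pt 0) (d / 2) ∪ closedBall (D.pt 1) (d / 2) ∧ 1 ≤ ‖w‖ := fun w => by
    rw [hK, mem_inter_iff, mem_preimage, mem_setOf_eq]
  have hKc : IsClosed K := by
    rw [hK]
    exact ((isClosed_closedBall.union isClosed_closedBall).preimage H.continuous).inter
      (isClosed_le continuous_const continuous_norm)
  have hptS : ∀ i : Fin 2, D.pt i ∈ closedBall (D.pt 0) (d / 2) ∪ closedBall (D.pt 1) (d / 2) :=
    Fin.forall_fin_two.2 ⟨mem_union_left _ (mem_closedBall_self (half_pos hd).le),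
      mem_union_right _ (mem_closedBall_self (half_pos hd).le)⟩
  have hptK : ∀ i, H.symm (D.pt i) ∈ K := fun i =>
    (hmemK _).2 ⟨by rw [H.apply_symm_apply]; exact hptS i,
      (hsymmFr _ (D.pt_mem_frontier i)).ge⟩
  have hKne : K.Nonempty := ⟨_, hptK 0⟩
  /- (3) The stretch factor and the radial stretch `Ψ`. -/
  obtain ⟨g, h1, h2, hsc, hc, hgK, hgnK, hgle⟩ := exists_stretchFactor hKc hKne
  obtain ⟨Ψ, hΨ, hΨsymm⟩ := exists_radialStretch h1 h2 hsc hc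
  /- (4) The enlarged domain `D' = Φ(D)`, `Φ = H ∘ Ψ ∘ H⁻¹`: `p ∈ D' ↔ ‖H⁻¹ p‖ < g (H⁻¹ p)`. -/
  obtain ⟨D', hD'⟩ : ∃ D' : DobrushinDomain, D' = D.map (H.symm.trans (Ψ.trans H)) := ⟨_, rfl⟩
  have hmemD' : ∀ p, p ∈ D'.carrier ↔ ‖H.symm p‖ < g (H.symm p) := fun p => by
    rw [hD', MarkedDomain.carrier_map, Homeomorph.image_eq_preimage_symm, mem_preimage,
      Homeomorph.symm_trans_apply, Homeomorph.symm_trans_apply, Homeomorph.symm_symm, hmemD,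
      hΨsymm]
  have hpt : ∀ i, D'.pt i = D.pt i := fun i => by
    rw [hD', MarkedDomain.pt_map, Homeomorph.trans_apply, Homeomorph.trans_apply, hΨ,
      hgK _ (hsymmFr _ (D.pt_mem_frontier i)) (hptK i), Complex.ofReal_one, one_mul,
      H.apply_symm_apply]
  have hsub : D.carrier ⊆ D'.carrier := fun p hp =>
    (hmemD' p).2 ((hsymmD p hp).trans_le (h1 _))
  /- (5) The compact set of points of `closure D` at distance `≥ d` from the marks lies in the
  open set `D'`, hence so does a uniform closed collar about it. -/
  have hT₀ : closure D.carrier ∩ ({z | d ≤ dist z (D.pt 0)} ∩ {z | d ≤ dist z (D.pt 1)}) ⊆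
      D'.carrier := by
    rintro z ⟨hz, hza, hzb⟩
    have hza : d ≤ dist z (D.pt 0) := hza
    have hzb : d ≤ dist z (D.pt 1) := hzb
    rw [closure_eq_self_union_frontier] at hz
    rcases hz with hz | hz
    · exact hsub hz
    · have hu : ‖H.symm z‖ = 1 := hsymmFr z hz
      rw [hmemD', hu]
      refine hgnK _ hu fun huK => ?_
      have hzS := ((hmemK _).1 huK).1
      rw [H.apply_symm_apply] at hzS
      rcases hzS with hzS | hzS <;> rw [mem_closedBall] at hzS <;> linarith
  have hT₀c : IsCompact
      (closure D.carrier ∩ ({z | d ≤ dist z (D.pt 0)} ∩ {z | d ≤ dist z (D.pt 1)})) :=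
    D.isBounded.isCompact_closure.inter_right
      ((isClosed_le continuous_const (continuous_id.dist continuous_const)).inter
        (isClosed_le continuous_const (continuous_id.dist continuous_const)))
  obtain ⟨ε, hε, hεsub⟩ := hT₀c.exists_cthickening_subset_open D'.isOpen hT₀
  refine ⟨D', ε, hε, hsub, hpt 0, hpt 1, ?_, fun z hz hza hzb => ?_⟩
  · /- sockets: `D' ∩ (B(a, d/2) ∪ B(b, d/2)) ⊆ D`. -/
    rintro p ⟨hpD', hpS⟩
    have hw := (hmemD' p).1 hpD'
    by_cases hw1 : ‖H.symm p‖ < 1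
    · have h := (hmemD _).2 hw1
      rwa [H.apply_symm_apply] at h
    · rw [not_lt] at hw1
      have hwK : H.symm p ∈ K := by
        refine (hmemK _).2 ⟨?_, hw1⟩
        rw [H.apply_symm_apply]
        rcases hpS with h | h
        · exact mem_union_left _ (ball_subset_closedBall h)
        · exact mem_union_right _ (ball_subset_closedBall h)
      exact absurd hw (not_lt.2 (hgle _ hw1 hwK))
  · /- room: the closed `ε`-ball about a point of the compact set lies in its `ε`-thickening. -/
    have hzT : z ∈ closure D.carrier ∩ ({z | d ≤ dist z (D.pt 0)} ∩ {z | d ≤ dist z (D.pt 1)}) :=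
      ⟨hz, hza, hzb⟩
    exact (closedBall_subset_cthickening hzT ε).trans hεsub

end Summit.CriticalPhenomena.SAWScalingLimit.Theorems
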